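import Summits.AtomisticToContinuum.HydrodynamicLimit.Theses.AthermalClockWard
import Literature.Analysis.FunctionSpaces.TorusSpaceTime
import Literature.Analysis.FunctionSpaces.TorusCalculusProofs

/-!
# Birth skeleton (BC3) for the crux `MomentumFluxResponse` (stmt-AtomisticToContinuum-17510), line `birth`

Route `AthermalClockWard` (`Summits/AtomisticToContinuum/HydrodynamicLimit/Theses/AthermalClockWard.lean`,
crux rank 3). The crux, read back: in the dilute band (`∃ η`, packing guard `ρ_t(x)σ³ < η`), along every
classical hard-sphere Euler solution on `[0,T)`, for every flow family with the `t = 0` law of large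
numbers, every `t < T`, smooth `χ` and `j`, the ONE-DIRECTION MOMENTUM RESPONSE
`Cov_N(s) := Cov_{LG_N}(K_N, ⟨m_N(Φ_{N,s} z), χ⟩_j)` (with the initial energy score
`K_N = Σ_i[(|v_i|² − v_i·u₀(x_i))/θ₀(x_i) − 3]`) converges UNIFORMLY in `s ∈ [0,t]` to
`s ∂_s ∫χρ_s u_{s,j} + ∫χρ_s u_{s,j} = ∂_s (s ∫χρ_s u_{s,j})`.

## The line: WARD PRIMITIVE + C¹-INTERPOLATION ("C⁰ convergence + temporal modulus ⇒ C¹ convergence")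

By the athermal Ward identity (momentum clause; stub W below, exactly the middle clause of the route's
provable-now support item `WardIdentity`, stmt-AtomisticToContinuum-11931) the response `Cov_N(s)` IS, at
every finite `N` and every `s > 0`, the time derivative of the weighted MEAN momentum field
`s ↦ s·V_j^N(s)`, `V_j^N(s) := E_{LG_N}⟨m_N(Φ_{N,s} z), χ⟩_j`. The crux is therefore a statement of
C¹-convergence of the primitives `s V_j^N(s) → s g_j(s)`, `g_j(s) := ∫χρ_s u_{s,j}`, and it splits along the
classical interpolation inequality (Landau–Kolmogorov / Arzelà–Ascoli; proved below as
`tendstoUniformlyOn_of_deriv_interpolation`)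

  `‖Cov_N − (s g_j)′‖_∞,[0,t] ≤ 2 ‖s V_j^N − s g_j‖_∞ / h + ω_N(h) + ω(h)`     (any mesh `h > 0`)

into its two genuinely different halves, which are exactly the two failure modes named in the crux's
"why it might fail":

* stub A `stub_meanMomentumUniform` (open, XL — LOCAL EQUILIBRIUM IN MEAN for the FIRST velocity moment,
  uniformly on compact pre-shock time intervals): `V_j^N(s) → ∫χρ_s u_{s,j}` uniformly in `s ∈ [0,t]`.
  An `N`-independent non-Euler part of the mean stress makes the mean momentum field drift off the Euler
  solution and kills A. It is the time-uniform form of the momentum clause of the route's target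
  `MeanHydroLimitInBand` and is implied by the crux (given W and the energy bound of `LocalGibbsStatics`:
  `sV = ∫₀ˢ Cov_N`), but carries no flux information, so it does not give the crux back.
* stub B `stub_responseEquicontinuous` (open, L — NO KINETIC-FREQUENCY OSCILLATION of the mean momentum
  current): the family `s ↦ Cov_N(s)` has an `N`-uniform temporal modulus of continuity on `[0,t]`,
  eventually in `N`. By W, `Cov_N(s) = V_j^N(s) + s·∂_s V_j^N(s)`, and `∂_s` of the mean momentum current is
  (collision rate `≍ N^{1/3}` per particle) × (mean collisional change of `v⊗v`), bounded uniformly in `N`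
  only if the two-body law at contact stays within `O(Kn)` of detailed balance for the quadratic moment —
  no a-priori estimate gives this at fixed reduced density. B is implied by the crux (a uniform limit of a
  continuous target is uniformly equicontinuous eventually) and plainly does not imply it.

Neither stub alone, nor W, is the crux or the summit in costume (BC3 probes `stub → MomentumFluxResponse`,
`stub → _root_.HydrodynamicLimit` by `first | exact? | simpa | aesop` all fail, see the seat's NOTES.md);
W ∧ A ∧ B ⇒ crux is the kernel-checked composition `MomentumFluxResponse_of` below (the interpolation
lemma on `[0,t']`, `t' = (t+T)/2 > t`, plus the Euler-side `C¹` regularity of `s ↦ ∫χρ_s u_{s,j}` from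
`IsSmoothSpaceTimeOn` — `Torus.IsSmoothSpaceTimeOn.hasDerivWithinAt_integral`, `.continuousOn_integral`).
The point `s = 0`, where W is silent, is reached through B (equicontinuity) from the interior estimate.

Docking: W is discharged BY NAME from the route item `WardIdentity` (`stub_wardMomentum_of_wardIdentity`,
proved). Disproof used: none on file (`ledger crux ls stmt-AtomisticToContinuum-17510`: no workfiles at
registration, 2026-08-17). Dead lines: none recorded for this crux. Negatives index: no entry is a
mean-field or modulus-of-continuity statement of this kind.
-/

noncomputable section

open MeasureTheory Set Filter Topology
open scoped BigOperators InnerProductSpace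

namespace Summit.AtomisticToContinuum.HydrodynamicLimit.Cruxes.MomentumFluxResponse.Birth

open Literature.MathematicalPhysics.KineticTheory Literature.Analysis.FluidPDE Literature.Analysis.FunctionSpaces
open Summit.AtomisticToContinuum.HydrodynamicLimit.Theses.AthermalClockWard (MomentumFluxResponse WardIdentity)

/-! ## The registered stubs (D-0027 §3.3 shape: sorried theorems in `Holds`, statements by name, `_of`) -/

namespace Holds

/-- **Stub W (finite-`N` identity; provable now, M–L; = the momentum clause of the route's support item
`WardIdentity`, stmt-AtomisticToContinuum-11931).** ATHERMAL WARD IDENTITY, momentum clause: for `σ > 0`,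
`t > 0`, continuous positive profiles, every `N`, flow `Φ`, continuous `χ` and `j`, with
`P = localGibbsLaw σ a₀ u₀ θ₀ N Φ` and the initial energy score `K(z) = Σ_i[(|v_i|² − ⟪v_i,u₀(x_i)⟫)/θ₀(x_i) − 3]`,
the weighted mean momentum field `s ↦ s · E_P⟨m_N(Φ_s z), χ⟩_j` has derivative
`Cov_P(K, ⟨m_N(Φ_t ·), χ⟩_j)` at `t`. Mechanism: `scaleVel c` pushes `LG(a,u,θ)` to `LG(a,cu,c²θ)` and
conjugates `Φ_t` to `Φ_{ct}` (`IsHardSphereTrajectory.timeDilate`), so `E_{LG(a,cu,c²θ)}⟨m_N(Φ_t),χ⟩ =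
c·E_{LG}⟨m_N(Φ_{ct}),χ⟩`; differentiate the exponential family in `c` at `1` under `∫` (score `K`, mean `0`). -/
theorem stub_wardMomentum :
    ∀ (σ t : ℝ), 0 < σ → 0 < t → ∀ (a₀ θ₀ : Literature.MathematicalPhysics.KineticTheory.T3 → ℝ) (u₀ : Literature.MathematicalPhysics.KineticTheory.T3 → Literature.MathematicalPhysics.KineticTheory.V3), Continuous a₀ → Continuous θ₀ → Continuous u₀ → (∀ x, 0 < a₀ x) → (∀ x, 0 < θ₀ x) → ∀ (N : ℕ) (Φ : Literature.Analysis.FluidPDE.HardSphereFlow (Literature.Analysis.FluidPDE.Torus.geometry (Fin 3)) (Literature.MathematicalPhysics.KineticTheory.hsDiameter σ N) (N + 1)) (χ : Literature.MathematicalPhysics.KineticTheory.T3 → ℝ), Continuous χ → let P : MeasureTheory.Measure (Literature.Analysis.FluidPDE.Config (N + 1) (Fin 3) Literature.MathematicalPhysics.KineticTheory.T3) := Literature.MathematicalPhysics.KineticTheory.localGibbsLaw σ a₀ u₀ θ₀ N Φ; let K : Literature.Analysis.FluidPDE.Config (N + 1) (Fin 3) Literature.MathematicalPhysics.KineticTheory.T3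 → ℝ := fun z => ∑ i, ((‖(z i).2‖ ^ 2 - ⟪(z i).2, u₀ (z i).1⟫_ℝ) / θ₀ (z i).1 - 3); ∀ j : Fin 3, HasDerivAt (fun s : ℝ => s * ∫ z, Literature.MathematicalPhysics.KineticTheory.empiricalMomentumField (Φ.flow s z) χ j ∂P) (ProbabilityTheory.covariance K (fun z => Literature.MathematicalPhysics.KineticTheory.empiricalMomentumField (Φ.flow t z) χ j) P) t := by
  sorry

/-- **Stub A (dynamical; OPEN, XL — local equilibrium in mean for the first velocity moment).**
TIME-UNIFORM MEAN MOMENTUM LAW in the dilute band: with the crux's prefix (packing threshold `η`,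
continuous positive profiles, `0 < σ < σ₀`, a classical hard-sphere Euler solution on `[0,T)` whose packing
stays below `η`, a flow family, the `t = 0` law of large numbers), for every `t < T`, smooth `χ` and `j`, the
EXPECTED empirical momentum field `E_{LG_N}⟨m_N(Φ_{N,s} z), χ⟩_j` converges to `∫ χ ρ_s u_{s,j}` UNIFORMLY in
`s ∈ [0,t]`. Why it might fail: an `N`-independent non-Euler (anisotropic / non-virial) part of the mean
stress at fixed small `σ` before the shock makes the mean momentum field drift off the Euler solution — the
closure problem in mean (Spohn 1991 §3.2 (3.14)–(3.16)); implied by the crux given W, not conversely. -/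
theorem stub_meanMomentumUniform :
    ∃ η : ℝ, 0 < η ∧ ∀ (a₀ θ₀ : Literature.MathematicalPhysics.KineticTheory.T3 → ℝ) (u₀ : Literature.MathematicalPhysics.KineticTheory.T3 → Literature.MathematicalPhysics.KineticTheory.V3), Continuous a₀ → Continuous θ₀ → Continuous u₀ → (∀ x, 0 < a₀ x) → (∀ x, 0 < θ₀ x) → ∃ σ₀ : ℝ, 0 < σ₀ ∧ ∀ σ : ℝ, 0 < σ → σ < σ₀ → ∀ (T : ℝ) (ρ θ : ℝ → Literature.MathematicalPhysics.KineticTheory.T3 → ℝ) (u : ℝ → Literature.MathematicalPhysics.KineticTheory.T3 → Literature.MathematicalPhysics.KineticTheory.V3), Literature.MathematicalPhysics.KineticTheory.IsHardSphereEulerSolution σ T ρ u θ → (∀ t ∈ Set.Ico 0 T, ∀ x, ρ t x * σ ^ 3 < η) → ∀ Φ : (N : ℕ) → Literature.Analysis.FluidPDE.HardSphereFlow (Literature.Analysis.FluidPDE.Torus.geometry (Fin 3)) (Literature.MathematicalPhysics.KineticTheory.hsDiameter σ N) (N + 1), Literature.MathematicalPhysics.KineticTheory.TendstoHydroFieldsAt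 (fun N => Literature.MathematicalPhysics.KineticTheory.localGibbsLaw σ a₀ u₀ θ₀ N (Φ N)) Φ ρ u θ 0 → ∀ t ∈ Set.Ico 0 T, ∀ χ : Literature.MathematicalPhysics.KineticTheory.T3 → ℝ, Literature.Analysis.FunctionSpaces.Torus.IsSmooth χ → ∀ j : Fin 3, TendstoUniformlyOn (fun (N : ℕ) (s : ℝ) => ∫ z, Literature.MathematicalPhysics.KineticTheory.empiricalMomentumField ((Φ N).flow s z) χ j ∂(Literature.MathematicalPhysics.KineticTheory.localGibbsLaw σ a₀ u₀ θ₀ N (Φ N))) (fun s => ∫ x, χ x * ρ s x * u s x j) Filter.atTop (Set.Icc 0 t) := by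
  sorry

/-- **Stub B (dynamical; OPEN, L — no kinetic-frequency oscillation of the mean momentum current).**
TEMPORAL EQUICONTINUITY OF THE ONE-DIRECTION MOMENTUM RESPONSE: with the crux's prefix, for every `t < T`,
smooth `χ`, `j` and `ε > 0` there are `δ > 0` and `N₀` such that for all `N ≥ N₀` and `s, s' ∈ [0,t]` with
`|s − s'| < δ`: `|Cov_N(s) − Cov_N(s')| < ε`, where `Cov_N(s) = Cov_{LG_N}(K_N, ⟨m_N(Φ_{N,s} z), χ⟩_j)` is the
crux's covariance. By W, `Cov_N(s) = V_j^N(s) + s ∂_s V_j^N(s)`: an `N`-uniform modulus of continuity in time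
of the mean momentum CURRENT. Why it might fail: `∂_s` of the mean momentum current is (collision rate
`≍ N^{1/3}` per particle) × (mean collisional change of `v ⊗ v`), bounded uniformly in `N` only if the
two-body law at contact stays within `O(Kn)` of detailed balance for the quadratic moment; a mean stress
oscillating at kinetic frequency kills it (and the crux). Implied by the crux, not conversely. -/
theorem stub_responseEquicontinuous :
    ∃ η : ℝ, 0 < η ∧ ∀ (a₀ θ₀ : Literature.MathematicalPhysics.KineticTheory.T3 → ℝ) (u₀ : Literature.MathematicalPhysics.KineticTheory.T3 → Literature.MathematicalPhysics.KineticTheory.V3), Continuous a₀ → Continuous θ₀ → Continuous u₀ → (∀ x, 0 < a₀ x) → (∀ x, 0 < θ₀ x) → ∃ σ₀ : ℝ, 0 < σ₀ ∧ ∀ σ : ℝ, 0 < σ → σ < σ₀ → ∀ (T : ℝ) (ρ θ : ℝ → Literature.MathematicalPhysics.KineticTheory.T3 → ℝ) (u : ℝ → Literature.MathematicalPhysics.KineticTheory.T3 → Literature.MathematicalPhysics.KineticTheory.V3), Literature.MathematicalPhysics.KineticTheory.IsHardSphereEulerSolution σ T ρ u θ → (∀ t ∈ Set.Ico 0 T,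 ∀ x, ρ t x * σ ^ 3 < η) → ∀ Φ : (N : ℕ) → Literature.Analysis.FluidPDE.HardSphereFlow (Literature.Analysis.FluidPDE.Torus.geometry (Fin 3)) (Literature.MathematicalPhysics.KineticTheory.hsDiameter σ N) (N + 1), Literature.MathematicalPhysics.KineticTheory.TendstoHydroFieldsAt (fun N => Literature.MathematicalPhysics.KineticTheory.localGibbsLaw σ a₀ u₀ θ₀ N (Φ N)) Φ ρ u θ 0 → ∀ t ∈ Set.Ico 0 T, ∀ χ : Literature.MathematicalPhysics.KineticTheory.T3 → ℝ, Literature.Analysis.FunctionSpaces.Torus.IsSmooth χ → let P : (N : ℕ) → MeasureTheory.Measure (Literature.Analysis.FluidPDE.Config (N + 1) (Fin 3) Literature.MathematicalPhysics.KineticTheory.T3) := fun N => Literature.MathematicalPhysics.KineticTheory.localGibbsLaw σ a₀ u₀ θ₀ N (Φ N); let K : (N : ℕ) → Literature.Analysis.FluidPDE.Config (N + 1) (Fin 3) Literature.MathematicalPhysics.KineticTheory.T3 → ℝ := fun _ z => ∑ i, ((‖(z i).2‖ ^ 2 - ⟪(z i).2, u₀ (z i).1⟫_ℝ) / θ₀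 (z i).1 - 3); ∀ j : Fin 3, ∀ ε : ℝ, 0 < ε → ∃ δ : ℝ, 0 < δ ∧ ∃ N₀ : ℕ, ∀ N : ℕ, N₀ ≤ N → ∀ s ∈ Set.Icc 0 t, ∀ s' ∈ Set.Icc 0 t, |s - s'| < δ → |ProbabilityTheory.covariance (K N) (fun z => Literature.MathematicalPhysics.KineticTheory.empiricalMomentumField ((Φ N).flow s z) χ j) (P N) - ProbabilityTheory.covariance (K N) (fun z => Literature.MathematicalPhysics.KineticTheory.empiricalMomentumField ((Φ N).flow s' z) χ j) (P N)| < ε := by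
  sorry

end Holds

/-! ## The stub statements by name (hypotheses of `MomentumFluxResponse_of`) -/

/-- Statement of `Holds.stub_wardMomentum` (registered stub W; provable now — see
`stub_wardMomentum_of_wardIdentity`). -/
def stub_wardMomentum : Prop := type_of% Holds.stub_wardMomentum

/-- Statement of `Holds.stub_meanMomentumUniform` (registered stub A, load-bearing). -/
def stub_meanMomentumUniform : Prop := type_of% Holds.stub_meanMomentumUniform

/-- Statement of `Holds.stub_responseEquicontinuous` (registered stub B). -/
def stub_responseEquicontinuous : Prop := type_of% Holds.stub_responseEquicontinuous

/-! ## Docking: stub W is the momentum clause of the route item `WardIdentity` -/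

/-- Stub W is discharged BY NAME by the route's support item `WardIdentity`
(stmt-AtomisticToContinuum-11931): it is literally its middle clause. -/
theorem stub_wardMomentum_of_wardIdentity (h : WardIdentity) : stub_wardMomentum := by
  intro σ t hσ ht a₀ θ₀ u₀ ha hθ hu ha0 hθ0 N Φ χ hχ
  exact (show _ ∧ _ ∧ _ from h σ t hσ ht a₀ θ₀ u₀ ha hθ hu ha0 hθ0 N Φ χ hχ).2.1

/-! ## Proved glue: the C¹-interpolation lemma -/

/-- One segment of the interpolation estimate: if `Ψ` has derivative `ψ` within `[a,b]` and
`|ψ − c| ≤ M` on `[a,b]`, then `|Ψ b − Ψ a − c (b − a)| ≤ M (b − a)` (mean value inequality applied to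
`x ↦ Ψ x − c x`). -/
theorem abs_sub_sub_mul_le_of_hasDerivWithinAt {a b : ℝ} (hab : a ≤ b) {Ψ ψ : ℝ → ℝ} {c M : ℝ}
    (hΨ : ∀ x ∈ Icc a b, HasDerivWithinAt Ψ (ψ x) (Icc a b) x)
    (hψ : ∀ x ∈ Icc a b, |ψ x - c| ≤ M) :
    |Ψ b - Ψ a - c * (b - a)| ≤ M * (b - a) := by
  have hD : ∀ x ∈ Icc a b, HasDerivWithinAt (fun x => Ψ x - c * x) (ψ x - c) (Icc a b) x := by
    intro x hx
    have h1 : HasDerivWithinAt (fun y : ℝ => c * y) (c * 1) (Icc a b) x :=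
      (hasDerivWithinAt_id x (Icc a b)).const_mul c
    rw [mul_one] at h1
    exact (hΨ x hx).sub h1
  have hB : ∀ x ∈ Ico a b, ‖ψ x - c‖ ≤ M := fun x hx => by
    rw [Real.norm_eq_abs]; exact hψ x (Ico_subset_Icc_self hx)
  have h := norm_image_sub_le_of_norm_deriv_le_segment' hD hB b (right_mem_Icc.2 hab)
  rw [Real.norm_eq_abs] at h
  have hrw : Ψ b - c * b - (Ψ a - c * a) = Ψ b - Ψ a - c * (b - a) := by ring
  rwa [hrw] at h

/-- **C¹-interpolation (Landau–Kolmogorov / Arzelà–Ascoli) lemma.** On `[0,t]`, `t > 0`: if the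
primitives `G N` converge uniformly to `G₀`, each `G N` has derivative `g N s` at every `0 < s ≤ t`,
`G₀` has derivative `g₀` within `[0,t]` with `g₀` continuous, and the derivatives `g N` are uniformly
equicontinuous on `[0,t]` eventually in `N`, then `g N → g₀` uniformly on `[0,t]`. Quantitatively,
`‖g N − g₀‖_∞ ≤ 2‖G N − G₀‖_∞ / h + ω_N(h) + ω_{g₀}(h)` for every mesh `0 < h ≤ t/4`; the endpoint `s = 0`
(no derivative information on `G N` there) is reached by equicontinuity from `s = h`. -/
theorem tendstoUniformlyOn_of_deriv_interpolation {t : ℝ} (ht : 0 < t)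
    {G g : ℕ → ℝ → ℝ} {G₀ g₀ : ℝ → ℝ}
    (hG : TendstoUniformlyOn G G₀ atTop (Icc 0 t))
    (hderiv : ∀ N : ℕ, ∀ s : ℝ, 0 < s → s ≤ t → HasDerivAt (G N) (g N s) s)
    (hG₀ : ∀ s ∈ Icc 0 t, HasDerivWithinAt G₀ (g₀ s) (Icc 0 t) s)
    (hg₀ : ContinuousOn g₀ (Icc 0 t))
    (heq : ∀ ε : ℝ, 0 < ε → ∃ δ : ℝ, 0 < δ ∧ ∃ N₀ : ℕ, ∀ N : ℕ, N₀ ≤ N →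
      ∀ s ∈ Icc 0 t, ∀ s' ∈ Icc 0 t, |s - s'| < δ → |g N s - g N s'| < ε) :
    TendstoUniformlyOn g g₀ atTop (Icc 0 t) := by
  rw [Metric.tendstoUniformlyOn_iff] at hG ⊢
  intro ε hε
  -- equicontinuity scale of the derivatives
  obtain ⟨δ₁, hδ₁, N₀, hE⟩ := heq (ε / 8) (by positivity)
  -- uniform continuity of the continuous target on the compact interval
  obtain ⟨δ₂, hδ₂, hU⟩ : ∃ δ₂ : ℝ, 0 < δ₂ ∧ ∀ s ∈ Icc 0 t, ∀ s' ∈ Icc 0 t,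
      |s - s'| < δ₂ → |g₀ s - g₀ s'| < ε / 8 := by
    have huc := isCompact_Icc.uniformContinuousOn_of_continuous hg₀
    rw [Metric.uniformContinuousOn_iff] at huc
    obtain ⟨δ, hδ, h⟩ := huc (ε / 8) (by positivity)
    refine ⟨δ, hδ, fun s hs s' hs' hss' => ?_⟩
    have := h s hs s' hs' (by rwa [Real.dist_eq])
    rwa [Real.dist_eq] at this
  -- the mesh
  set h : ℝ := min (min δ₁ δ₂) t / 4 with hh_def
  have hm0 : 0 < min (min δ₁ δ₂) t := lt_min (lt_min hδ₁ hδ₂) ht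
  have hh0 : 0 < h := by rw [hh_def]; positivity
  have hhδ₁ : h < δ₁ := by
    have : min (min δ₁ δ₂) t ≤ δ₁ := (min_le_left _ _).trans (min_le_left _ _)
    rw [hh_def]; linarith
  have hhδ₂ : h < δ₂ := by
    have : min (min δ₁ δ₂) t ≤ δ₂ := (min_le_left _ _).trans (min_le_right _ _)
    rw [hh_def]; linarith
  have hht : 4 * h ≤ t := by
    have : min (min δ₁ δ₂) t ≤ t := min_le_right _ _
    rw [hh_def]; linarith
  -- primitives `ε h / 8`-close, eventually
  have hG' := hG (ε * h / 8) (by positivity)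
  filter_upwards [hG', eventually_ge_atTop N₀] with N hGN hN
  have hEN := hE N hN
  -- interior estimate on a segment `[a, a + h] ⊆ (0, t]`
  have key : ∀ a : ℝ, 0 < a → a + h ≤ t → ∀ s ∈ Icc a (a + h), |g₀ s - g N s| < ε / 2 := by
    intro a ha hat s hs
    have hsub : Icc a (a + h) ⊆ Icc 0 t := Icc_subset_Icc ha.le hat
    have hΨ : ∀ x ∈ Icc a (a + h),
        HasDerivWithinAt (fun x => G N x - G₀ x) (g N x - g₀ x) (Icc a (a + h)) x := by
      intro x hx
      have hx0 : 0 < x := ha.trans_le hx.1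
      have hxt : x ≤ t := hx.2.trans hat
      exact (hderiv N x hx0 hxt).hasDerivWithinAt.sub ((hG₀ x ⟨hx0.le, hxt⟩).mono hsub)
    have hψ : ∀ x ∈ Icc a (a + h), |(g N x - g₀ x) - (g N s - g₀ s)| ≤ ε / 4 := by
      intro x hx
      have hxs₁ : |x - s| < δ₁ := by
        rw [abs_sub_lt_iff]; constructor <;> linarith [hx.1, hx.2, hs.1, hs.2]
      have hxs₂ : |x - s| < δ₂ := by
        rw [abs_sub_lt_iff]; constructor <;> linarith [hx.1, hx.2, hs.1, hs.2]
      have e1 := hEN x (hsub hx) s (hsub hs) hxs₁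
      have e2 := hU x (hsub hx) s (hsub hs) hxs₂
      have hrw : (g N x - g₀ x) - (g N s - g₀ s) = (g N x - g N s) - (g₀ x - g₀ s) := by ring
      rw [hrw]
      calc |(g N x - g N s) - (g₀ x - g₀ s)| ≤ |g N x - g N s| + |g₀ x - g₀ s| := abs_sub _ _
        _ ≤ ε / 4 := by linarith
    have hseg := abs_sub_sub_mul_le_of_hasDerivWithinAt (by linarith) hΨ hψ
    have hba : a + h - a = h := by ring
    rw [hba] at hseg
    have hGa := hGN a (hsub (left_mem_Icc.2 (by linarith)))
    have hGb := hGN (a + h) (hsub (right_mem_Icc.2 (by linarith)))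
    rw [Real.dist_eq] at hGa hGb
    -- `|c| h ≤ |X - Y - c h| + |X| + |Y| < ε h / 4 + ε h / 8 + ε h / 8`
    have hrw : (g N s - g₀ s) * h =
        (G N (a + h) - G₀ (a + h)) - (G N a - G₀ a) -
          (G N (a + h) - G₀ (a + h) - (G N a - G₀ a) - (g N s - g₀ s) * h) := by ring
    have e1 := abs_sub ((G N (a + h) - G₀ (a + h)) - (G N a - G₀ a))
      (G N (a + h) - G₀ (a + h) - (G N a - G₀ a) - (g N s - g₀ s) * h)
    rw [← hrw] at e1
    have e2 := abs_sub (G N (a + h) - G₀ (a + h)) (G N a - G₀ a)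
    have hXa : |G N a - G₀ a| < ε * h / 8 := by rw [abs_sub_comm]; exact hGa
    have hXb : |G N (a + h) - G₀ (a + h)| < ε * h / 8 := by rw [abs_sub_comm]; exact hGb
    have h1 : |(g N s - g₀ s) * h| = |g N s - g₀ s| * h := by rw [abs_mul, abs_of_pos hh0]
    have hprod : |g N s - g₀ s| * h < ε / 2 * h := by linarith
    rw [abs_sub_comm]
    exact lt_of_mul_lt_mul_right hprod hh0.le
  -- conclusion at every point of `[0, t]`
  intro s hs
  rw [Real.dist_eq]
  rcases hs.1.eq_or_lt with hs0 | hs0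
  · -- `s = 0`: through the interior point `h`
    subst hs0
    have hhI : h ∈ Icc (0 : ℝ) t := ⟨hh0.le, by linarith⟩
    have h1 : |g₀ h - g N h| < ε / 2 := key h hh0 (by linarith) h (left_mem_Icc.2 (by linarith))
    have h2 : |g N h - g N 0| < ε / 8 :=
      hEN h hhI 0 ⟨le_rfl, ht.le⟩ (by rw [sub_zero, abs_of_pos hh0]; exact hhδ₁)
    have h3 : |g₀ 0 - g₀ h| < ε / 8 :=
      hU 0 ⟨le_rfl, ht.le⟩ h hhI (by rw [zero_sub, abs_neg, abs_of_pos hh0]; exact hhδ₂)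
    calc |g₀ 0 - g N 0| = |(g₀ 0 - g₀ h) + (g₀ h - g N h) + (g N h - g N 0)| := by ring_nf
      _ ≤ |g₀ 0 - g₀ h| + |g₀ h - g N h| + |g N h - g N 0| := abs_add_three _ _ _
      _ < ε := by linarith
  · by_cases hst : s ≤ t / 2
    · exact (key s hs0 (by linarith) s (left_mem_Icc.2 (by linarith))).trans (by linarith)
    · have hst' : t / 2 < s := not_le.1 hst
      have ha : 0 < s - h := by linarith
      have := key (s - h) ha (by linarith [hs.2]) s ⟨by linarith, by linarith⟩
      exact this.trans (by linarith)

/-! ## Composition: the three stubs give the crux BY NAME -/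

/-- **`stub_wardMomentum → stub_meanMomentumUniform → stub_responseEquicontinuous → MomentumFluxResponse`**
(hypotheses = the three registered stub statements BY NAME; kernel-checked, no `sorry`).
Thresholds `η := min η_A η_B`, `σ₀ := min σ_A σ_B`. Given a guarded classical solution on `[0,T)`, a flow
family with the `t = 0` LLN, `t < T`, smooth `χ` and `j`: work on the longer pre-shock interval `[0,t']`,
`t' := (t+T)/2 ∈ (t, T)`, `t' > 0`. Euler side: `g(s) = ∫χρ_s u_{s,j}` is `C¹` on `[0,T)` by joint
smoothness (`Torus.IsSmoothSpaceTimeOn.hasDerivWithinAt_integral`, `.continuousOn_integral`,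
`.timeDerivWithin`), so `s g(s)` has the continuous derivative `s·derivWithin g (Ico 0 T) s + g s` within
`[0,t']`. Microscopic side: stub A times `s ≤ t'` gives `s V_N(s) → s g(s)` uniformly on `[0,t']`; stub W
gives `(s V_N)′(s) = Cov_N(s)` for `s > 0`; stub B gives the temporal modulus. The interpolation lemma
`tendstoUniformlyOn_of_deriv_interpolation` yields `Cov_N → (s g)′` uniformly on `[0,t']`, restricted to
`[0,t]` — verbatim the crux's conclusion. -/
theorem MomentumFluxResponse_of (hW : stub_wardMomentum) (hA : stub_meanMomentumUniform)
    (hB : stub_responseEquicontinuous) :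
    Summit.AtomisticToContinuum.HydrodynamicLimit.Theses.AthermalClockWard.MomentumFluxResponse := by
  obtain ⟨η₁, hη₁, HA⟩ := (hA : type_of% Holds.stub_meanMomentumUniform)
  obtain ⟨η₂, hη₂, HB⟩ := (hB : type_of% Holds.stub_responseEquicontinuous)
  refine ⟨min η₁ η₂, lt_min hη₁ hη₂, ?_⟩
  intro a₀ θ₀ u₀ ha hθ hu ha0 hθ0
  obtain ⟨σ₁, hσ₁, GA⟩ := HA a₀ θ₀ u₀ ha hθ hu ha0 hθ0
  obtain ⟨σ₂, hσ₂, GB⟩ := HB a₀ θ₀ u₀ ha hθ hu ha0 hθ0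
  refine ⟨min σ₁ σ₂, lt_min hσ₁ hσ₂, ?_⟩
  intro σ hσ hσlt T ρ θ u hE hpack Φ h0 t ht χ hχ P K j
  have hσ₁' : σ < σ₁ := hσlt.trans_le (min_le_left _ _)
  have hσ₂' : σ < σ₂ := hσlt.trans_le (min_le_right _ _)
  have hp1 : ∀ s ∈ Ico 0 T, ∀ x, ρ s x * σ ^ 3 < η₁ :=
    fun s hs x => (hpack s hs x).trans_le (min_le_left _ _)
  have hp2 : ∀ s ∈ Ico 0 T, ∀ x, ρ s x * σ ^ 3 < η₂ :=
    fun s hs x => (hpack s hs x).trans_le (min_le_right _ _)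
  -- a slightly longer pre-shock interval `[0, t']`, `t < t' < T`, `0 < t'`
  have ht0 : 0 ≤ t := ht.1
  have htT : t < T := ht.2
  set t' : ℝ := (t + T) / 2 with ht'_def
  have htt' : t < t' := by rw [ht'_def]; linarith
  have ht'T : t' < T := by rw [ht'_def]; linarith
  have ht'0 : 0 < t' := lt_of_le_of_lt ht0 htt'
  have ht' : t' ∈ Ico 0 T := ⟨ht'0.le, ht'T⟩
  -- the three stubs on `[0, t']`
  have hA' : TendstoUniformlyOn
      (fun (N : ℕ) (s : ℝ) => ∫ z, empiricalMomentumField ((Φ N).flow s z) χ j ∂(P N))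
      (fun s => ∫ x, χ x * ρ s x * u s x j) atTop (Icc 0 t') :=
    GA σ hσ hσ₁' T ρ θ u hE hp1 Φ h0 t' ht' χ hχ j
  have hB' : ∀ ε : ℝ, 0 < ε → ∃ δ : ℝ, 0 < δ ∧ ∃ N₀ : ℕ, ∀ N : ℕ, N₀ ≤ N →
      ∀ s ∈ Icc 0 t', ∀ s' ∈ Icc 0 t', |s - s'| < δ →
        |ProbabilityTheory.covariance (K N) (fun z => empiricalMomentumField ((Φ N).flow s z) χ j) (P N) -
          ProbabilityTheory.covariance (K N) (fun z => empiricalMomentumField ((Φ N).flow s' z) χ j) (P N)| < ε :=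
    GB σ hσ hσ₂' T ρ θ u hE hp2 Φ h0 t' ht' χ hχ j
  have hW' : ∀ N : ℕ, ∀ s : ℝ, 0 < s → s ≤ t' →
      HasDerivAt (fun s : ℝ => s * ∫ z, empiricalMomentumField ((Φ N).flow s z) χ j ∂(P N))
        (ProbabilityTheory.covariance (K N) (fun z => empiricalMomentumField ((Φ N).flow s z) χ j) (P N)) s :=
    fun N s hs _ =>
      (hW : type_of% Holds.stub_wardMomentum) σ s hσ hs a₀ θ₀ u₀ ha hθ hu ha0 hθ0 N (Φ N) χ hχ.continuous j
  -- Euler side: `g(s) = ∫ χ ρ_s u_{s,j}` is `C¹` on `[0,T)`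
  set g : ℝ → ℝ := fun s => ∫ x, χ x * ρ s x * u s x j with hg_def
  have hsm : Torus.IsSmoothSpaceTimeOn (Ico 0 T) (fun s x => χ x * ρ s x * u s x j) :=
    ((Torus.isSmoothSpaceTimeOn_const hχ (Ico 0 T)).mul hE.smooth_density).mul
      (hE.smooth_velocity.apply j)
  have hUD : UniqueDiffOn ℝ (Ico (0 : ℝ) T) := uniqueDiffOn_Ico 0 T
  set g' : ℝ → ℝ := fun s =>
    ∫ x, Torus.timeDerivWithin (Ico 0 T) (fun s x => χ x * ρ s x * u s x j) s x with hg'_def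
  have hgd : ∀ s ∈ Ico 0 T, HasDerivWithinAt g (g' s) (Ico 0 T) s :=
    fun s hs => hsm.hasDerivWithinAt_integral (convex_Ico 0 T) hs
  have hgdW : ∀ s ∈ Ico 0 T, derivWithin g (Ico 0 T) s = g' s :=
    fun s hs => (hgd s hs).derivWithin (hUD s hs)
  have hgc : ContinuousOn g (Ico 0 T) := hsm.continuousOn_integral (convex_Ico 0 T)
  have hg'c : ContinuousOn g' (Ico 0 T) :=
    (hsm.timeDerivWithin hUD).continuousOn_integral (convex_Ico 0 T)
  have hsubT : Icc 0 t' ⊆ Ico 0 T := fun s hs => ⟨hs.1, hs.2.trans_lt ht'T⟩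
  -- the target `s g(s)` and its (continuous) derivative within `[0, t']`
  have hFd : ∀ s ∈ Icc 0 t',
      HasDerivWithinAt (fun s => s * g s) (s * derivWithin g (Ico 0 T) s + g s) (Icc 0 t') s := by
    intro s hs
    have h1 : HasDerivWithinAt g (derivWithin g (Ico 0 T) s) (Icc 0 t') s := by
      rw [hgdW s (hsubT hs)]
      exact (hgd s (hsubT hs)).mono hsubT
    have h2 := (hasDerivWithinAt_id s (Icc 0 t')).mul h1
    exact h2.congr_deriv (by rw [id_eq, one_mul, add_comm])
  have hfc : ContinuousOn (fun s => s * derivWithin g (Ico 0 T) s + g s) (Icc 0 t') := by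
    refine ContinuousOn.add (continuousOn_id.mul ?_) (hgc.mono hsubT)
    exact (hg'c.mono hsubT).congr fun s hs => hgdW s (hsubT hs)
  -- weighted means: `s V_N(s) → s g(s)` uniformly on `[0, t']` (stub A, `s ≤ t'`)
  have hSV : TendstoUniformlyOn
      (fun (N : ℕ) (s : ℝ) => s * ∫ z, empiricalMomentumField ((Φ N).flow s z) χ j ∂(P N))
      (fun s => s * g s) atTop (Icc 0 t') := by
    rw [Metric.tendstoUniformlyOn_iff] at hA' ⊢
    intro ε hε
    filter_upwards [hA' (ε / t') (div_pos hε ht'0)] with N hN s hs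
    have h1 := hN s hs
    rw [Real.dist_eq] at h1 ⊢
    have hs' : |s| ≤ t' := by rw [abs_of_nonneg hs.1]; exact hs.2
    calc |s * g s - s * ∫ z, empiricalMomentumField ((Φ N).flow s z) χ j ∂(P N)|
        = |s| * |g s - ∫ z, empiricalMomentumField ((Φ N).flow s z) χ j ∂(P N)| := by
          rw [← mul_sub, abs_mul]
      _ ≤ t' * |g s - ∫ z, empiricalMomentumField ((Φ N).flow s z) χ j ∂(P N)| :=
          mul_le_mul_of_nonneg_right hs' (abs_nonneg _)
      _ < t' * (ε / t') := mul_lt_mul_of_pos_left h1 ht'0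
      _ = ε := by field_simp
  -- C¹-interpolation on `[0, t']` (stubs W and B), then restrict to `[0, t]`
  have hmain := tendstoUniformlyOn_of_deriv_interpolation ht'0 hSV hW' hFd hfc hB'
  exact hmain.mono (Icc_subset_Icc le_rfl htt'.le)

end Summit.AtomisticToContinuum.HydrodynamicLimit.Cruxes.MomentumFluxResponse.Birth

end
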